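import Summits.CriticalPhenomena.PercolationContinuityZ3.Theorems.PercNearOneGluingNoHeavyLowerTailCoinStubShape
import HarnessLib

/-!
# `NoHeavyLowerTail` (stmt-CriticalPhenomena-4575) — the FREE-EDGE STEP of the pattern-lightest bound and the typed target
# "glue-step + glued observers ⇒ crux"

Support file (prover `prim-hp-8`, PL programme; `--supports stmt-CriticalPhenomena-4575`).  No definitions, no named facts, no sorries.
Notation of `…CoinPatterns.lean`: observer `o ∉ A`, ranking `r` (injective on `A`, compatible with lightness in `H` = the weights with the pairs
at `o` switched off), selection events `Sel_b`, `R_b`, `L`, `Φ_r(v) = Σ_{b∈A} μ_v(Sel_b)·μ_v(R_b) − μ_v(L)`.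

For a pair `o–y` of weight `u` (`y` any vertex ≠ `o`), `v⁰ = v[oy ↦ 0]`, `v¹ = v[oy ↦ 1]`, the one-bond expansion reads
`Φ_r(v) = (1−u)Φ_r(v⁰) + uΦ_r(v¹) + u(1−u)X`, `X = Σ_b (μ_{v¹}(Sel_b) − μ_{v⁰}(Sel_b))(μ_{v⁰}(R_b) − μ_{v¹}(R_b))`.  The GLUE-STEP inequality
  `(B*)   Σ_b μ_{v¹}(Sel_b)·μ_{v⁰}(R_b) − μ_{v¹}(L) ≥ Σ_b μ_{v⁰}(Sel_b)·(μ_{v⁰}(R_b) − μ_{v¹}(R_b))`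
is `Φ_r(v¹) + X ≥ 0`; it is a theorem when `y` is a relay (`CoinReduction.gluedCoin_nonneg` + `coinCross_nonneg` give the two terms separately) and
census-clean for free `y` (0 / 14 764, memo PROOF-COIN-REDUCTION.md §8).

* `freeEdgeStep` — `(B*)` for `(v⁰, y)` implies `Φ_r(v) ≥ (1−u)·Φ_r(v⁰) + u²·Φ_r(v¹)` (nonnegative coefficients).
* `patternLightest_of_glueStep_of_glued` — hence, by induction on the number of fractional non-loop pairs at `o`: if `(B*)` holds for every free `y`
  not adjacent to `o` (in every instance with the same `H`) and `Φ_r ≥ 0` for every DETERMINISTIC observer (all non-loop pairs at `o` of weight `0`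
  or `1`) with the same `H`, then `Φ_r(v) ≥ 0`.  Coins are removed by `CoinReduction.coinStep`.
* `noHeavyLowerTail_of_glueStep_of_glued` — typed target: the two hypotheses for all graphs ⇒ `NoHeavyLowerTail`.  Compared with
  `CoinReduction.noHeavyLowerTail_of_conjS` this needs only the DIAGONAL of Conjecture S (glued observers) plus the one-vertex glue-step `(B*)`.
-/

noncomputable section

namespace Summit.CriticalPhenomena.PercolationContinuityZ3.Theorems

namespace CoinReduction

open MeasureTheory Set Literature.Probability.LatticeModels Literature.Probability.Percolation
open scoped Classical BigOperators

variable {n : ℕ}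

/-- **The free-edge step.**  For any pair `e = s(o,y)` with `u = v e`: if the glue-step inequality `(B*)` holds between `v⁰ = v[e↦0]` and
`v¹ = v[e↦1]`, then `(1−u)·Φ_r(v⁰) + u²·Φ_r(v¹) ≤ Φ_r(v)`. [folklore — one-bond expansion] -/
theorem freeEdgeStep (v : Sym2 (Fin n) → unitInterval) (A : Finset (Fin n)) (j : ℕ) (o y : Fin n) (r : Fin n → ℕ)
    (hB : ∑ b ∈ A, (prodBernoulli (Function.update v s(o, y) 0)).real {ω : BondConfig (Fin n) |
            b ∈ (A.filter fun b' => ω ∈ openConnIn ((↑A : Set (Fin n))ᶜ ∪ {b'}) o b') ∧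
            ∀ b' ∈ A, r b' < r b → b' ∉ (A.filter fun b'' => ω ∈ openConnIn ((↑A : Set (Fin n))ᶜ ∪ {b''}) o b'')} *
          ((prodBernoulli (Function.update v s(o, y) 0)).real
              {ω : BondConfig (Fin n) | (A.filter fun z => ω ∈ openConn b z).card ≤ j} -
            (prodBernoulli (Function.update v s(o, y) 1)).real
              {ω : BondConfig (Fin n) | (A.filter fun z => ω ∈ openConn b z).card ≤ j}) ≤
        ∑ b ∈ A, (prodBernoulli (Function.update v s(o, y) 1)).real {ω : BondConfig (Fin n) |
            b ∈ (A.filter fun b' => ω ∈ openConnIn ((↑A : Set (Fin n))ᶜ ∪ {b'}) o b') ∧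
            ∀ b' ∈ A, r b' < r b → b' ∉ (A.filter fun b'' => ω ∈ openConnIn ((↑A : Set (Fin n))ᶜ ∪ {b''}) o b'')} *
          (prodBernoulli (Function.update v s(o, y) 0)).real
            {ω : BondConfig (Fin n) | (A.filter fun z => ω ∈ openConn b z).card ≤ j} -
        (prodBernoulli (Function.update v s(o, y) 1)).real {ω : BondConfig (Fin n) |
          1 ≤ (A.filter fun z => ω ∈ openConn o z).card ∧ (A.filter fun z => ω ∈ openConn o z).card ≤ j}) :
    (1 - (v s(o, y) : ℝ)) *
        (∑ b ∈ A, (prodBernoulli (Function.update v s(o, y) 0)).real {ω : BondConfig (Fin n) |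
            b ∈ (A.filter fun b' => ω ∈ openConnIn ((↑A : Set (Fin n))ᶜ ∪ {b'}) o b') ∧
            ∀ b' ∈ A, r b' < r b → b' ∉ (A.filter fun b'' => ω ∈ openConnIn ((↑A : Set (Fin n))ᶜ ∪ {b''}) o b'')} *
          (prodBernoulli (Function.update v s(o, y) 0)).real
            {ω : BondConfig (Fin n) | (A.filter fun z => ω ∈ openConn b z).card ≤ j} -
        (prodBernoulli (Function.update v s(o, y) 0)).real {ω : BondConfig (Fin n) |
          1 ≤ (A.filter fun z => ω ∈ openConn o z).card ∧ (A.filter fun z => ω ∈ openConn o z).card ≤ j}) +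
      (v s(o, y) : ℝ) ^ 2 *
        (∑ b ∈ A, (prodBernoulli (Function.update v s(o, y) 1)).real {ω : BondConfig (Fin n) |
            b ∈ (A.filter fun b' => ω ∈ openConnIn ((↑A : Set (Fin n))ᶜ ∪ {b'}) o b') ∧
            ∀ b' ∈ A, r b' < r b → b' ∉ (A.filter fun b'' => ω ∈ openConnIn ((↑A : Set (Fin n))ᶜ ∪ {b''}) o b'')} *
          (prodBernoulli (Function.update v s(o, y) 1)).real
            {ω : BondConfig (Fin n) | (A.filter fun z => ω ∈ openConn b z).card ≤ j} -
        (prodBernoulli (Function.update v s(o, y) 1)).real {ω : BondConfig (Fin n) |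
          1 ≤ (A.filter fun z => ω ∈ openConn o z).card ∧ (A.filter fun z => ω ∈ openConn o z).card ≤ j}) ≤
      ∑ b ∈ A, (prodBernoulli v).real {ω : BondConfig (Fin n) |
          b ∈ (A.filter fun b' => ω ∈ openConnIn ((↑A : Set (Fin n))ᶜ ∪ {b'}) o b') ∧
          ∀ b' ∈ A, r b' < r b → b' ∉ (A.filter fun b'' => ω ∈ openConnIn ((↑A : Set (Fin n))ᶜ ∪ {b''}) o b'')} *
        (prodBernoulli v).real {ω : BondConfig (Fin n) | (A.filter fun z => ω ∈ openConn b z).card ≤ j} -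
      (prodBernoulli v).real {ω : BondConfig (Fin n) |
        1 ≤ (A.filter fun z => ω ∈ openConn o z).card ∧ (A.filter fun z => ω ∈ openConn o z).card ≤ j} := by
  set e : Sym2 (Fin n) := s(o, y) with he
  set μ := prodBernoulli v with hμ
  set μ0 := prodBernoulli (Function.update v e 0) with hμ0
  set μ1 := prodBernoulli (Function.update v e 1) with hμ1
  set u : ℝ := (v e : ℝ) with hu
  have hu0 : 0 ≤ u := (v e).2.1
  have hu1 : u ≤ 1 := (v e).2.2
  set Sel : Fin n → Set (BondConfig (Fin n)) := fun b => {ω |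
    b ∈ (A.filter fun b' => ω ∈ openConnIn ((↑A : Set (Fin n))ᶜ ∪ {b'}) o b') ∧
    ∀ b' ∈ A, r b' < r b → b' ∉ (A.filter fun b'' => ω ∈ openConnIn ((↑A : Set (Fin n))ᶜ ∪ {b''}) o b'')} with hSel
  set R : Fin n → Set (BondConfig (Fin n)) := fun b => {ω | (A.filter fun z => ω ∈ openConn b z).card ≤ j} with hR
  set L : Set (BondConfig (Fin n)) := {ω | 1 ≤ (A.filter fun z => ω ∈ openConn o z).card ∧
    (A.filter fun z => ω ∈ openConn o z).card ≤ j} with hL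
  have hexpS : ∀ b, μ.real (Sel b) = (1 - u) * μ0.real (Sel b) + u * μ1.real (Sel b) :=
    fun b => TieLocus.real_oneBond v e (Sel b)
  have hexpR : ∀ b, μ.real (R b) = (1 - u) * μ0.real (R b) + u * μ1.real (R b) :=
    fun b => TieLocus.real_oneBond v e (R b)
  have hexpL : μ.real L = (1 - u) * μ0.real L + u * μ1.real L := TieLocus.real_oneBond v e L
  have hsum : ∑ b ∈ A, μ.real (Sel b) * μ.real (R b) =
      (1 - u) * ∑ b ∈ A, μ0.real (Sel b) * μ0.real (R b) + u * ∑ b ∈ A, μ1.real (Sel b) * μ1.real (R b) +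
        u * (1 - u) * ∑ b ∈ A, (μ1.real (Sel b) - μ0.real (Sel b)) * (μ0.real (R b) - μ1.real (R b)) := by
    rw [Finset.mul_sum, Finset.mul_sum, Finset.mul_sum, ← Finset.sum_add_distrib, ← Finset.sum_add_distrib]
    apply Finset.sum_congr rfl
    intro b _
    rw [hexpS b, hexpR b]
    ring
  -- the hypothesis says Φ(v¹) + X ≥ 0
  have hBX : 0 ≤ (∑ b ∈ A, μ1.real (Sel b) * μ1.real (R b) - μ1.real L) +
      ∑ b ∈ A, (μ1.real (Sel b) - μ0.real (Sel b)) * (μ0.real (R b) - μ1.real (R b)) := by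
    have h : ∑ b ∈ A, μ0.real (Sel b) * (μ0.real (R b) - μ1.real (R b)) ≤
        ∑ b ∈ A, μ1.real (Sel b) * μ0.real (R b) - μ1.real L := hB
    have hid : (∑ b ∈ A, μ1.real (Sel b) * μ1.real (R b) - μ1.real L) +
        ∑ b ∈ A, (μ1.real (Sel b) - μ0.real (Sel b)) * (μ0.real (R b) - μ1.real (R b)) =
        (∑ b ∈ A, μ1.real (Sel b) * μ0.real (R b) - μ1.real L) -
          ∑ b ∈ A, μ0.real (Sel b) * (μ0.real (R b) - μ1.real (R b)) := by
      have : ∑ b ∈ A, μ1.real (Sel b) * μ1.real (R b) +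
          ∑ b ∈ A, (μ1.real (Sel b) - μ0.real (Sel b)) * (μ0.real (R b) - μ1.real (R b)) =
          ∑ b ∈ A, μ1.real (Sel b) * μ0.real (R b) - ∑ b ∈ A, μ0.real (Sel b) * (μ0.real (R b) - μ1.real (R b)) := by
        rw [← Finset.sum_add_distrib, ← Finset.sum_sub_distrib]
        apply Finset.sum_congr rfl; intro b _; ring
      linarith
    rw [hid]; linarith
  change (1 - u) * (∑ b ∈ A, μ0.real (Sel b) * μ0.real (R b) - μ0.real L) +
      u ^ 2 * (∑ b ∈ A, μ1.real (Sel b) * μ1.real (R b) - μ1.real L) ≤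
    ∑ b ∈ A, μ.real (Sel b) * μ.real (R b) - μ.real L
  rw [hsum, hexpL]
  nlinarith [mul_nonneg (mul_nonneg hu0 (sub_nonneg.2 hu1)) hBX]

/-- **Glue-step for every free non-neighbour + positivity for deterministic observers ⇒ the pattern-lightest bound.**  Fix `H` (the weights
off the pairs at `o`), `A`, `o ∉ A`, `j`, and an `H`-compatible injective ranking `r`.  Suppose that for every weight function `w` agreeing with
`v` off the pairs at `o`: (i) `(B*)` holds for every non-relay `y ≠ o` with `w s(o,y) = 0`, and (ii) `Φ_r(w) ≥ 0` whenever every non-loop pair at `o`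
has weight `0` or `1` under `w`.  Then `Φ_r(v) ≥ 0`.  (Induction on the number of fractional non-loop pairs at `o`: coins by `coinStep`, free pairs
by `freeEdgeStep`.) [folklore] -/
theorem patternLightest_of_glueStep_of_glued (v : Sym2 (Fin n) → unitInterval) (A : Finset (Fin n)) (j : ℕ) (o : Fin n)
    (r : Fin n → ℕ) (hr : Set.InjOn r ↑A) (hoA : o ∉ A)
    (hcompat : ∀ b ∈ A, ∀ b' ∈ A, r b < r b' →
      (prodBernoulli fun e : Sym2 (Fin n) => if e ∈ {e : Sym2 (Fin n) | o ∉ e} then v e else 0).real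
          {ω : BondConfig (Fin n) | (A.filter fun z => ω ∈ openConn b' z).card ≤ j} ≤
        (prodBernoulli fun e : Sym2 (Fin n) => if e ∈ {e : Sym2 (Fin n) | o ∉ e} then v e else 0).real
          {ω : BondConfig (Fin n) | (A.filter fun z => ω ∈ openConn b z).card ≤ j})
    (hglue : ∀ (w : Sym2 (Fin n) → unitInterval) (y : Fin n), (∀ e : Sym2 (Fin n), o ∉ e → w e = v e) →
      y ≠ o → y ∉ A → w s(o, y) = 0 →
      ∑ b ∈ A, (prodBernoulli w).real {ω : BondConfig (Fin n) |
            b ∈ (A.filter fun b' => ω ∈ openConnIn ((↑A : Set (Fin n))ᶜ ∪ {b'}) o b') ∧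
            ∀ b' ∈ A, r b' < r b → b' ∉ (A.filter fun b'' => ω ∈ openConnIn ((↑A : Set (Fin n))ᶜ ∪ {b''}) o b'')} *
          ((prodBernoulli w).real {ω : BondConfig (Fin n) | (A.filter fun z => ω ∈ openConn b z).card ≤ j} -
            (prodBernoulli (Function.update w s(o, y) 1)).real
              {ω : BondConfig (Fin n) | (A.filter fun z => ω ∈ openConn b z).card ≤ j}) ≤
        ∑ b ∈ A, (prodBernoulli (Function.update w s(o, y) 1)).real {ω : BondConfig (Fin n) |
            b ∈ (A.filter fun b' => ω ∈ openConnIn ((↑A : Set (Fin n))ᶜ ∪ {b'}) o b') ∧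
            ∀ b' ∈ A, r b' < r b → b' ∉ (A.filter fun b'' => ω ∈ openConnIn ((↑A : Set (Fin n))ᶜ ∪ {b''}) o b'')} *
          (prodBernoulli w).real {ω : BondConfig (Fin n) | (A.filter fun z => ω ∈ openConn b z).card ≤ j} -
        (prodBernoulli (Function.update w s(o, y) 1)).real {ω : BondConfig (Fin n) |
          1 ≤ (A.filter fun z => ω ∈ openConn o z).card ∧ (A.filter fun z => ω ∈ openConn o z).card ≤ j})
    (hglued : ∀ (w : Sym2 (Fin n) → unitInterval), (∀ e : Sym2 (Fin n), o ∉ e → w e = v e) →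
      (∀ y : Fin n, y ≠ o → w s(o, y) = 0 ∨ w s(o, y) = 1) →
      (prodBernoulli w).real {ω : BondConfig (Fin n) |
          1 ≤ (A.filter fun z => ω ∈ openConn o z).card ∧ (A.filter fun z => ω ∈ openConn o z).card ≤ j} ≤
        ∑ b ∈ A, (prodBernoulli w).real {ω : BondConfig (Fin n) |
            b ∈ (A.filter fun b' => ω ∈ openConnIn ((↑A : Set (Fin n))ᶜ ∪ {b'}) o b') ∧
            ∀ b' ∈ A, r b' < r b → b' ∉ (A.filter fun b'' => ω ∈ openConnIn ((↑A : Set (Fin n))ᶜ ∪ {b''}) o b'')} *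
          (prodBernoulli w).real {ω : BondConfig (Fin n) | (A.filter fun z => ω ∈ openConn b z).card ≤ j}) :
    (prodBernoulli v).real {ω : BondConfig (Fin n) |
        1 ≤ (A.filter fun z => ω ∈ openConn o z).card ∧ (A.filter fun z => ω ∈ openConn o z).card ≤ j} ≤
      ∑ b ∈ A, (prodBernoulli v).real {ω : BondConfig (Fin n) |
          b ∈ (A.filter fun b' => ω ∈ openConnIn ((↑A : Set (Fin n))ᶜ ∪ {b'}) o b') ∧
          ∀ b' ∈ A, r b' < r b → b' ∉ (A.filter fun b'' => ω ∈ openConnIn ((↑A : Set (Fin n))ᶜ ∪ {b''}) o b'')} *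
        (prodBernoulli v).real {ω : BondConfig (Fin n) | (A.filter fun z => ω ∈ openConn b z).card ≤ j} := by
  set Sel : Fin n → Set (BondConfig (Fin n)) := fun b => {ω |
    b ∈ (A.filter fun b' => ω ∈ openConnIn ((↑A : Set (Fin n))ᶜ ∪ {b'}) o b') ∧
    ∀ b' ∈ A, r b' < r b → b' ∉ (A.filter fun b'' => ω ∈ openConnIn ((↑A : Set (Fin n))ᶜ ∪ {b''}) o b'')} with hSel
  set R : Fin n → Set (BondConfig (Fin n)) := fun b => {ω | (A.filter fun z => ω ∈ openConn b z).card ≤ j} with hR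
  set L : Set (BondConfig (Fin n)) := {ω | 1 ≤ (A.filter fun z => ω ∈ openConn o z).card ∧
    (A.filter fun z => ω ∈ openConn o z).card ≤ j} with hL
  set Φ : (Sym2 (Fin n) → unitInterval) → ℝ :=
    fun w => ∑ b ∈ A, (prodBernoulli w).real (Sel b) * (prodBernoulli w).real (R b) - (prodBernoulli w).real L with hΦ
  suffices H : ∀ (k : ℕ) (w : Sym2 (Fin n) → unitInterval),
      (Finset.univ.filter fun y : Fin n => y ≠ o ∧ w s(o, y) ≠ 0 ∧ w s(o, y) ≠ 1).card = k →
      (∀ e : Sym2 (Fin n), o ∉ e → w e = v e) → 0 ≤ Φ w by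
    have h := H _ v rfl (fun e _ => rfl)
    change (prodBernoulli v).real L ≤ ∑ b ∈ A, (prodBernoulli v).real (Sel b) * (prodBernoulli v).real (R b)
    have : Φ v = ∑ b ∈ A, (prodBernoulli v).real (Sel b) * (prodBernoulli v).real (R b) - (prodBernoulli v).real L := rfl
    linarith
  have hagree : ∀ (w : Sym2 (Fin n) → unitInterval) (y : Fin n) (t : unitInterval),
      (∀ e : Sym2 (Fin n), o ∉ e → w e = v e) → ∀ e : Sym2 (Fin n), o ∉ e → Function.update w s(o, y) t e = v e := by
    intro w y t hw e he
    have hne : e ≠ s(o, y) := fun h => he (h ▸ Sym2.mem_mk_left o y)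
    rw [Function.update_of_ne hne]; exact hw e he
  have hcount : ∀ (w : Sym2 (Fin n) → unitInterval) (y : Fin n), y ≠ o → w s(o, y) ≠ 0 → w s(o, y) ≠ 1 →
      ∀ t : unitInterval, (t = 0 ∨ t = 1) →
      (Finset.univ.filter fun z : Fin n => z ≠ o ∧ Function.update w s(o, y) t s(o, z) ≠ 0 ∧
        Function.update w s(o, y) t s(o, z) ≠ 1).card <
      (Finset.univ.filter fun z : Fin n => z ≠ o ∧ w s(o, z) ≠ 0 ∧ w s(o, z) ≠ 1).card := by
    intro w y hyo hy0 hy1 t ht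
    apply Finset.card_lt_card
    rw [Finset.ssubset_iff_of_subset]
    · refine ⟨y, Finset.mem_filter.2 ⟨Finset.mem_univ _, hyo, hy0, hy1⟩, ?_⟩
      intro h
      have h' := (Finset.mem_filter.1 h).2.2
      rw [Function.update_self] at h'
      rcases ht with ht | ht
      · exact h'.1 ht
      · exact h'.2 ht
    · intro z hz
      have hz' := (Finset.mem_filter.1 hz).2
      refine Finset.mem_filter.2 ⟨Finset.mem_univ _, hz'.1, ?_⟩
      by_cases hzf : s(o, z) = s(o, y)
      · rw [hzf, Function.update_self] at hz'
        rcases ht with ht | ht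
        · exact absurd ht hz'.2.1
        · exact absurd ht hz'.2.2
      · have h2 := hz'.2
        rwa [Function.update_of_ne hzf] at h2
  intro k
  induction k using Nat.strong_induction_on with
  | _ k ih =>
  intro w hk hw
  have hres : (fun e : Sym2 (Fin n) => if e ∈ {e : Sym2 (Fin n) | o ∉ e} then w e else 0) =
      fun e : Sym2 (Fin n) => if e ∈ {e : Sym2 (Fin n) | o ∉ e} then v e else 0 := by
    funext e
    by_cases he : e ∈ {e : Sym2 (Fin n) | o ∉ e}
    · simp only [he, if_true]; exact hw e he
    · simp only [he, if_false]
  have hcompat_w : ∀ b ∈ A, ∀ b' ∈ A, r b < r b' →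
      (prodBernoulli fun e : Sym2 (Fin n) => if e ∈ {e : Sym2 (Fin n) | o ∉ e} then w e else 0).real (R b') ≤
        (prodBernoulli fun e : Sym2 (Fin n) => if e ∈ {e : Sym2 (Fin n) | o ∉ e} then w e else 0).real (R b) := by
    rw [hres]; exact hcompat
  by_cases hfrac : ∃ y : Fin n, y ≠ o ∧ w s(o, y) ≠ 0 ∧ w s(o, y) ≠ 1
  · obtain ⟨y, hyo, hy0, hy1⟩ := hfrac
    have ih0 : 0 ≤ Φ (Function.update w s(o, y) 0) :=
      ih _ (by rw [← hk]; exact hcount w y hyo hy0 hy1 0 (Or.inl rfl)) _ rfl (hagree w y 0 hw)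
    by_cases hyA : y ∈ A
    · -- a coin: the one-coin step
      have hstep : (1 - (w s(o, y) : ℝ)) * Φ (Function.update w s(o, y) 0) ≤ Φ w :=
        coinStep w A j r hr hoA hyA hcompat_w
      have h1 : 0 ≤ 1 - (w s(o, y) : ℝ) := sub_nonneg.2 (w s(o, y)).2.2
      nlinarith [mul_nonneg h1 ih0]
    · -- a free pair: the free-edge step
      have ih1 : 0 ≤ Φ (Function.update w s(o, y) 1) :=
        ih _ (by rw [← hk]; exact hcount w y hyo hy0 hy1 1 (Or.inr rfl)) _ rfl (hagree w y 1 hw)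
      set w0 := Function.update w s(o, y) 0 with hw0
      have hw00 : w0 s(o, y) = 0 := by rw [hw0, Function.update_self]
      have hB := hglue w0 y (hagree w y 0 hw) hyo hyA hw00
      have hw01 : Function.update w0 s(o, y) 1 = Function.update w s(o, y) 1 := by
        rw [hw0, Function.update_idem]
      rw [hw01, hw0] at hB
      have hstep := freeEdgeStep w A j o y r hB
      have h1 : 0 ≤ 1 - (w s(o, y) : ℝ) := sub_nonneg.2 (w s(o, y)).2.2
      have h2 : 0 ≤ (w s(o, y) : ℝ) ^ 2 := sq_nonneg _
      have e1 : Φ (Function.update w s(o, y) 0) =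
          ∑ b ∈ A, (prodBernoulli (Function.update w s(o, y) 0)).real (Sel b) *
            (prodBernoulli (Function.update w s(o, y) 0)).real (R b) - (prodBernoulli (Function.update w s(o, y) 0)).real L := rfl
      have e2 : Φ (Function.update w s(o, y) 1) =
          ∑ b ∈ A, (prodBernoulli (Function.update w s(o, y) 1)).real (Sel b) *
            (prodBernoulli (Function.update w s(o, y) 1)).real (R b) - (prodBernoulli (Function.update w s(o, y) 1)).real L := rfl
      have e3 : Φ w = ∑ b ∈ A, (prodBernoulli w).real (Sel b) * (prodBernoulli w).real (R b) - (prodBernoulli w).real L := rfl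
      rw [e3]
      rw [← e1, ← e2] at hstep
      nlinarith [mul_nonneg h1 ih0, mul_nonneg h2 ih1]
  · push Not at hfrac
    have hdet : ∀ y : Fin n, y ≠ o → w s(o, y) = 0 ∨ w s(o, y) = 1 := by
      intro y hyo
      by_cases h : w s(o, y) = 0
      · exact Or.inl h
      · exact Or.inr (hfrac y hyo h)
    have h := hglued w hw hdet
    change 0 ≤ ∑ b ∈ A, (prodBernoulli w).real (Sel b) * (prodBernoulli w).real (R b) - (prodBernoulli w).real L
    linarith

/-- **Typed target: glue-step for free vertices + the pattern-lightest bound for glued (deterministic) observers ⇒ `NoHeavyLowerTail`.**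
Hypotheses, for every weighted graph on `Fin n`, relays `A`, observer `o ∉ A`, level `j`, and every injective `H`-compatible ranking `r`:
(GS) the glue-step inequality `(B*)` for every non-relay `y ≠ o` with `w s(o,y) = 0`; (GL) `Φ_r(w) ≥ 0` whenever all non-loop pairs at `o` have
weight `0` or `1`.  Conclusion: the crux, through `patternLightest_of_glueStep_of_glued`, `sum_sel_eq_sum_patterns`,
`exists_compatible_ranking` and `PatternLightest.noHeavyLowerTail_of_patternLightest`.  (Both hypotheses are census-clean and open; (GL) is the
diagonal of Conjecture S; memo PROOF-COIN-REDUCTION.md §8–9.) [folklore — reduction only] -/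
theorem noHeavyLowerTail_of_glueStep_of_glued
    (hGS : ∀ (n : ℕ) (w : Sym2 (Fin n) → unitInterval) (A : Finset (Fin n)) (o y : Fin n) (j : ℕ) (r : Fin n → ℕ),
      o ∉ A → Set.InjOn r ↑A →
      (∀ b ∈ A, ∀ b' ∈ A, r b < r b' →
        (Literature.Probability.LatticeModels.prodBernoulli fun e : Sym2 (Fin n) =>
            if e ∈ {e : Sym2 (Fin n) | o ∉ e} then w e else 0).real
            {ω : Literature.Probability.Percolation.BondConfig (Fin n) |
              (A.filter fun z => ω ∈ Literature.Probability.Percolation.openConn b' z).card ≤ j} ≤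
          (Literature.Probability.LatticeModels.prodBernoulli fun e : Sym2 (Fin n) =>
            if e ∈ {e : Sym2 (Fin n) | o ∉ e} then w e else 0).real
            {ω : Literature.Probability.Percolation.BondConfig (Fin n) |
              (A.filter fun z => ω ∈ Literature.Probability.Percolation.openConn b z).card ≤ j}) →
      y ≠ o → y ∉ A → w s(o, y) = 0 →
      ∑ b ∈ A, (Literature.Probability.LatticeModels.prodBernoulli w).real
            {ω : Literature.Probability.Percolation.BondConfig (Fin n) |
              b ∈ (A.filter fun b' => ω ∈ Literature.Probability.Percolation.openConnIn ((↑A : Set (Fin n))ᶜ ∪ {b'}) o b') ∧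
              ∀ b' ∈ A, r b' < r b →
                b' ∉ (A.filter fun b'' => ω ∈ Literature.Probability.Percolation.openConnIn ((↑A : Set (Fin n))ᶜ ∪ {b''}) o b'')} *
          ((Literature.Probability.LatticeModels.prodBernoulli w).real
              {ω : Literature.Probability.Percolation.BondConfig (Fin n) |
                (A.filter fun z => ω ∈ Literature.Probability.Percolation.openConn b z).card ≤ j} -
            (Literature.Probability.LatticeModels.prodBernoulli (Function.update w s(o, y) 1)).real
              {ω : Literature.Probability.Percolation.BondConfig (Fin n) |
                (A.filter fun z => ω ∈ Literature.Probability.Percolation.openConn b z).card ≤ j}) ≤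
        ∑ b ∈ A, (Literature.Probability.LatticeModels.prodBernoulli (Function.update w s(o, y) 1)).real
            {ω : Literature.Probability.Percolation.BondConfig (Fin n) |
              b ∈ (A.filter fun b' => ω ∈ Literature.Probability.Percolation.openConnIn ((↑A : Set (Fin n))ᶜ ∪ {b'}) o b') ∧
              ∀ b' ∈ A, r b' < r b →
                b' ∉ (A.filter fun b'' => ω ∈ Literature.Probability.Percolation.openConnIn ((↑A : Set (Fin n))ᶜ ∪ {b''}) o b'')} *
          (Literature.Probability.LatticeModels.prodBernoulli w).real
            {ω : Literature.Probability.Percolation.BondConfig (Fin n) |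
              (A.filter fun z => ω ∈ Literature.Probability.Percolation.openConn b z).card ≤ j} -
        (Literature.Probability.LatticeModels.prodBernoulli (Function.update w s(o, y) 1)).real
          {ω : Literature.Probability.Percolation.BondConfig (Fin n) |
            1 ≤ (A.filter fun z => ω ∈ Literature.Probability.Percolation.openConn o z).card ∧
            (A.filter fun z => ω ∈ Literature.Probability.Percolation.openConn o z).card ≤ j})
    (hGL : ∀ (n : ℕ) (w : Sym2 (Fin n) → unitInterval) (A : Finset (Fin n)) (o : Fin n) (j : ℕ) (r : Fin n → ℕ),
      o ∉ A → Set.InjOn r ↑A →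
      (∀ b ∈ A, ∀ b' ∈ A, r b < r b' →
        (Literature.Probability.LatticeModels.prodBernoulli fun e : Sym2 (Fin n) =>
            if e ∈ {e : Sym2 (Fin n) | o ∉ e} then w e else 0).real
            {ω : Literature.Probability.Percolation.BondConfig (Fin n) |
              (A.filter fun z => ω ∈ Literature.Probability.Percolation.openConn b' z).card ≤ j} ≤
          (Literature.Probability.LatticeModels.prodBernoulli fun e : Sym2 (Fin n) =>
            if e ∈ {e : Sym2 (Fin n) | o ∉ e} then w e else 0).real
            {ω : Literature.Probability.Percolation.BondConfig (Fin n) |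
              (A.filter fun z => ω ∈ Literature.Probability.Percolation.openConn b z).card ≤ j}) →
      (∀ y : Fin n, y ≠ o → w s(o, y) = 0 ∨ w s(o, y) = 1) →
      (Literature.Probability.LatticeModels.prodBernoulli w).real
          {ω : Literature.Probability.Percolation.BondConfig (Fin n) |
            1 ≤ (A.filter fun z => ω ∈ Literature.Probability.Percolation.openConn o z).card ∧
            (A.filter fun z => ω ∈ Literature.Probability.Percolation.openConn o z).card ≤ j} ≤
        ∑ b ∈ A, (Literature.Probability.LatticeModels.prodBernoulli w).real
            {ω : Literature.Probability.Percolation.BondConfig (Fin n) |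
              b ∈ (A.filter fun b' => ω ∈ Literature.Probability.Percolation.openConnIn ((↑A : Set (Fin n))ᶜ ∪ {b'}) o b') ∧
              ∀ b' ∈ A, r b' < r b →
                b' ∉ (A.filter fun b'' => ω ∈ Literature.Probability.Percolation.openConnIn ((↑A : Set (Fin n))ᶜ ∪ {b''}) o b'')} *
          (Literature.Probability.LatticeModels.prodBernoulli w).real
            {ω : Literature.Probability.Percolation.BondConfig (Fin n) |
              (A.filter fun z => ω ∈ Literature.Probability.Percolation.openConn b z).card ≤ j}) :
    Summit.CriticalPhenomena.PercolationContinuityZ3.Theses.PercNearOneGluing.NoHeavyLowerTail := by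
  apply PatternLightest.noHeavyLowerTail_of_patternLightest
  intro n w A o j hoA
  -- an H-compatible ranking and the r-argmin selection
  obtain ⟨r, hr, hcompat⟩ := exists_compatible_ranking
    (fun b => (prodBernoulli fun e : Sym2 (Fin n) => if e ∈ {e : Sym2 (Fin n) | o ∉ e} then w e else 0).real
      {ω : BondConfig (Fin n) | (A.filter fun z => ω ∈ openConn b z).card ≤ j}) A
  have hex : ∀ B : Finset (Fin n), B.Nonempty → ∃ b ∈ B, ∀ b' ∈ B, r b ≤ r b' :=
    fun B hB => Finset.exists_min_image B r hB
  set sel : Finset (Fin n) → Fin n := fun B => if h : B.Nonempty then Classical.choose (hex B h) else o with hseldef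
  have hsel : ∀ B : Finset (Fin n), B.Nonempty → sel B ∈ B ∧ ∀ b ∈ B, r (sel B) ≤ r b := by
    intro B hB
    have h := Classical.choose_spec (hex B hB)
    simp only [hseldef, dif_pos hB]
    exact ⟨h.1, h.2⟩
  refine ⟨sel, fun B hB => (hsel B (Finset.nonempty_iff_ne_empty.2 (Finset.ne_of_mem_erase hB))).1, ?_⟩
  have key := sum_sel_eq_sum_patterns (prodBernoulli w) A o r hr sel hsel
    (fun b => (prodBernoulli w).real {ω : BondConfig (Fin n) | (A.filter fun x => ω ∈ openConn b x).card ≤ j})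
  rw [← key]
  -- the restricted weights of any w' agreeing with w off o coincide with those of w
  have hres : ∀ w' : Sym2 (Fin n) → unitInterval, (∀ e : Sym2 (Fin n), o ∉ e → w' e = w e) →
      (fun e : Sym2 (Fin n) => if e ∈ {e : Sym2 (Fin n) | o ∉ e} then w' e else 0) =
        fun e : Sym2 (Fin n) => if e ∈ {e : Sym2 (Fin n) | o ∉ e} then w e else 0 := by
    intro w' hw'
    funext e
    by_cases he : e ∈ {e : Sym2 (Fin n) | o ∉ e}
    · simp only [he, if_true]; exact hw' e he
    · simp only [he, if_false]
  apply patternLightest_of_glueStep_of_glued w A j o r hr hoA hcompat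
  · intro w' y hw' hyo hyA hwy
    exact hGS n w' A o y j r hoA hr (by rw [hres w' hw']; exact hcompat) hyo hyA hwy
  · intro w' hw' hdet
    exact hGL n w' A o j r hoA hr (by rw [hres w' hw']; exact hcompat) hdet

end CoinReduction

end Summit.CriticalPhenomena.PercolationContinuityZ3.Theorems

end
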